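import Summits.QuantumFields.YangMills.Theorems.BalabanUVNodesSpineReadingOfRecord13CoPHK
import Summits.QuantumFields.YangMills.Theorems.BalabanUVNodesN19RekeyingCalculus
import Summits.QuantumFields.YangMills.Theorems.BalabanUVNodesN19CoreEdgeFSCComposer

/-!
# BalabanUVNodes ∕ N20 (NE7b) — THE BAD-KEY DIAL OF K3⁷ STUB 2 IS ELIMINABLE AT EVERY KEY READING (edition K of this seat's g4 `…N20CutDialElimination`): at dag-n20-d's
# key-reading edition `crOfRecord₁₃K kr bd sh` of the spine reading of record, for EVERY key reading `kr`, the stub-2 body «∃ bd sh cr, (live ⇒ cr = crOfRecord₁₃K kr bd sh) ∧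
# KeyedRelWeight cr ∧ KeyedShellWeight cr ∧ KeyedExtraction cr ∧ KeyedCoreEdgeHolderD4 β cr rr» is EQUIVALENT to its EMPTY-BAD-CLASS specialisation «∃ sh cr, (live ⇒ cr =
# crOfRecord₁₃K kr ⊥ sh) ∧ …» — a BUDGET-FREE fold, generic in `N`, the guard, the live predicate and the rates premise

Cell `pub-ymgap` (HUMAN RULING D-0062 Track A; work-bound push D-0149, director-ym №197), width seat `pub-ymgap-dag-n20-w1` (gen 5) on node N20 = NE7b; key item K3⁷
`SpineGivenEndpointR13SepCoPH` = stmt-QuantumFields-20544 (`--kind proof --supports 20544 --as helper`); COUNT-NEUTRAL.  Bus: CLAIM-12 ∕ INTENT-16 (INBOX l.31653).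
THEOREMS ONLY: no `def`, no `instance`, no `notation`, no `sorry`; imports dag-n20-d's `…SpineReadingOfRecord13CoPHK` (p608328: `crOfRecord₁₃KAt ∕ crOfRecord₁₃K`, `KeyReading₁₃`,
`BadKeyReading₁₃`, `classSetK₁₃ ∕ weightAK₁₃ ∕ weightBK₁₃ ∕ badClassK₁₃`, the four transfers `relWeightBound_∕shellWeightBound_∕core_crOfRecord₁₃KAt`, `crOfRecord₁₃K_id`), dag-n19-w1's
`…N19RekeyingCalculus` (p593255: the GENERIC folds `shellWeightBound_foldBad`, `core_foldBad`) and `…N19CoreEdgeFSCComposer` (the `ForSmallCouplings` prefix) — all BY NAME.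

WHY.  This seat's g4 (`…N20CutDialElimination`, p606432) folded v5's cut dial `jc` — the bad class `badClass₁₃ … (jc …)` of the PINNED reading `crOfRecord₁₃V (jc …) sh` — into the
shell split, budget-free: `stubTwoBody_iff_zeroCut` (plan g83 v6 BOOKING (3); by-name adapter `…N20CutDialStubText` p614769).  Meanwhile dag-n20-d g29 typed the KEY-READING
EDITION `crOfRecord₁₃K kr bd sh` (p608328; «the OBJECT a key-reading dial pins to»; v5's pin is its identity-dial instance `crOfRecord₁₃K_id`; the level window `windowKeyReading₁₃`
its first value; dag-n20-d on the bus: «`PinnedAtLiveK (kr) (bd) sh cr := … cr = crOfRecord₁₃K kr bd sh` is typable BY NAME … n20-w1's booked adapter and a v6 dial compose»).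
THIS FILE is that composition IN GENERAL: at EVERY key reading `kr` the bad-key dial `bd : BadKeyReading₁₃ N 0` is REDUNDANT in the stub-2 body — whatever `bd` a closing proof
uses, its witnesses FOLD to the EMPTY bad-key reading `⊥ := fun … ↦ False` (coarse bad class `∅`), the `bd`-bad coarse classes' whole class weights becoming shell parts of a
folded split `sh♯`; N20's face at `(kr, ⊥)` is FREE (empty bad class, §1), N21's face absorbs `W + Wsh` (dag-n19-w1's generic `shellWeightBound_foldBad` at the coarse carriers +
dag-n20-d's canonical transfer; NO `W + Wsh < 1` budget), N19′'s `∃ δ`-edge keeps its `δ` (`core_foldBad`), N27x does not read `bd ∕ sh`.  So a v6 that reads a key (`kr := wkey`,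
window-key-core K3 ∕ D1) may DROP the bad-key dial exactly as it may drop the cut dial: ★★ `stubTwoBodyK_iff_badFalse`.  At `kr := keyReadingId₁₃` and
`bd := fun … x ↦ KeyOldLargeField (jc … x.1) x.2` the pin below is v5's `PinnedAtLive jc sh cr` by dag-n20-d's `crOfRecord₁₃K_id` (pointwise in the tuple) — not re-derived here.
* §1 PER TUPLE AT `crOfRecord₁₃KAt K₀ kr bd sh` [bookkeeping]: `badClassK₁₃_false` (the empty bad-key reading books NOTHING) · ★ `relWeightBound_crOfRecord₁₃KAt_badFalse` (N20 FREE at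
  `(kr, ⊥)`, any split) · ★ `shellWeightBound_crOfRecord₁₃KAt_badFalse_of_faces` (N20 + N21 at `(kr, bd, sh)` ⇒ N21 at `(kr, ⊥, sh♯)`, NO budget) · ★ `coreEdge_crOfRecord₁₃KAt_badFalse_of_coreEdge`
  (`∃ δ, Core ∧ Summable` at `(kr, bd, sh)` ⇒ at `(kr, ⊥, sh♯)`, same `δ`) · `extraction_crOfRecord₁₃KAt_iff` (the N27x body does not read `bd ∕ sh`).
* §2 THE STUB-2 BODY AT A KEY READING [bookkeeping]: ★★ `exists_badFalse_of_exists` · ★★ `stubTwoBodyK_iff_badFalse` (the converse is the instance `bd := ⊥`).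

HONEST FRAMING.  [bookkeeping] over the tree's SHAPES and dag-n20-d's key-reading edition BY NAME; an EQUIVALENCE OF TWO HYPOTHESIS SHAPES — neither body is inhabited here, no
witness is built from Bałaban's objects (K3⁷ stub 2 OPEN; K0⁷ open); proves NO estimate; nothing of Bałaban's asserted; no key reading is PROPOSED (the dial's value is the plan's ∕
window-key-core's business).  NE7 ∕ NE7b ∕ NE7c NOT PRINTED for `d = 4`, NOT proved; N19 ∕ N20 ∕ N21 ∕ N27 NOT discharged; K3⁷ NOT closed; skeleton v5 941dddb108cbaacf UNTOUCHED;
counts unmoved (typed 28∕28 · discharged 5∕27); no count claim.  One finite `𝕋⁴_{L^K}` programme at fixed `ε = L^{−K}`, Bałaban AS PRINTED; the YM mass gap (Clay) is NOT proved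
by any of this — R4 closes the conditional finite-𝕋⁴ rung `BalabanLadder.UV` only; NOT ℝ⁴, NOT OS.  Sources (bookkeeping): [Balaban1988Convergent] (2.18) p.257;
[Balaban1989LargeFieldII] (1.80) p.384; [Balaban1987RG1] Thm 2 p.259.  No decl carries a cite tag.
-/

set_option autoImplicit false

noncomputable section

namespace Summit.QuantumFields.YangMills.BalabanUVNodes.N20BadDialEliminationAtKeyReading

open Finset
open Literature.MathematicalPhysics.QuantumFieldTheory.Balaban1983to89
open Literature.MathematicalPhysics.QuantumFieldTheory.Balaban1983to89.T4Continuum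
open Literature.MathematicalPhysics.QuantumFieldTheory.Balaban1983to89.Node00
open T4WeightBudget (RelWeightBound)
open T4IndicatorShell (ShellWeightBound)
open T4ContinuumYM4Torus (ForSmallCouplings)
open Summit.QuantumFields.BalabanUV.T4Continuum.Spine
open YMDAG.UVSplit hiding SU
open Summit.QuantumFields.YangMills.BalabanUVNodes.N19RekeyingCalculus (shellWeightBound_foldBad core_foldBad)

variable {F : T4Family} {N : ℕ} [NeZero N]

/-! ## §1  Per tuple: the budget-free fold AT the key-reading edition of the reading of record -/

section PerTuple

variable (K₀ : ℕ) (kr : KeyReading₁₃ N K₀) (bd bd' : BadKeyReading₁₃ N K₀) (sh sh' : ShellSplit₁₃CoPH N K₀) (θ : Stage13HParams F N) (hP : θ.Provisos₁₃CoPH F N)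
  (g₀ : ℕ → ℝ) (os : List (ULoop F))

/-- **THE EMPTY BAD-KEY READING BOOKS NOTHING**: at `bd := ⊥` the coarse bad class is `∅`, whatever the key reading. [bookkeeping] -/
theorem badClassK₁₃_false (krT : ℕ → (Σ K, SiteSeqKey F (K₀ + K)) → (Σ K, SiteSeqKey F (K₀ + K))) (K : ℕ) (t : ℝ) :
    badClassK₁₃ θ K₀ g₀ krT (fun _ _ => False) K t = ∅ := by
  unfold badClassK₁₃
  exact Finset.filter_false _

/-- ★ **N20 IS FREE AT THE EMPTY BAD-KEY READING** [bookkeeping]: at `crOfRecord₁₃KAt K₀ kr ⊥ sh` (any key reading, any split) the weight face holds — the bad class is empty, the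
canonical weight the least witness (dag-n20-d's transfer from the witness `W := 0`). -/
theorem relWeightBound_crOfRecord₁₃KAt_badFalse :
    RelWeightBound (crOfRecord₁₃KAt K₀ kr (fun _ _ _ _ _ _ _ => False) sh F θ hP g₀ os).l₀ (crOfRecord₁₃KAt K₀ kr (fun _ _ _ _ _ _ _ => False) sh F θ hP g₀ os).T
      (crOfRecord₁₃KAt K₀ kr (fun _ _ _ _ _ _ _ => False) sh F θ hP g₀ os).A (crOfRecord₁₃KAt K₀ kr (fun _ _ _ _ _ _ _ => False) sh F θ hP g₀ os).B
      (crOfRecord₁₃KAt K₀ kr (fun _ _ _ _ _ _ _ => False) sh F θ hP g₀ os).Bad (crOfRecord₁₃KAt K₀ kr (fun _ _ _ _ _ _ _ => False) sh F θ hP g₀ os).W := by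
  refine relWeightBound_crOfRecord₁₃KAt K₀ kr (fun _ _ _ _ _ _ _ => False) sh θ hP g₀ os (W := fun _ => 0) ?_
  exact
    { bad_subset := fun K t _ => badClassK₁₃_subset θ K₀ g₀ (kr F θ hP g₀ os) _ K t
      nonneg := fun _ => le_rfl
      lt_one := fun _ => zero_lt_one
      summable := summable_zero
      bad_left := fun K t _ => by rw [badClassK₁₃_false]; simp
      bad_right := fun K t _ => by rw [badClassK₁₃_false]; simp }

/-- ★ **N20 + N21 AT `(kr, bd, sh)` ⇒ N21 AT `(kr, ⊥, sh♯)` — NO BUDGET** [bookkeeping]: the reading's own fields `W`, `Wsh` are witnesses at the coarse carriers (definitionally),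
dag-n19-w1's generic `shellWeightBound_foldBad` folds them to a shell witness `W + Wsh` for the folded split `sh♯` («the whole coarse class weight on the `bd`-bad coarse classes,
`sh` off them», two displayed equations), and dag-n20-d's `shellWeightBound_crOfRecord₁₃KAt` re-canonicalises AT the reading `crOfRecord₁₃KAt K₀ kr ⊥ sh♯`. -/
theorem shellWeightBound_crOfRecord₁₃KAt_badFalse_of_faces
    (hfold₁ : letI : DecidableEq (Σ K, SiteSeqKey F (K₀ + K)) := Classical.decEq _
      ∀ (K : ℕ) (t : ℝ) (u : Σ K, SiteSeqKey F (K₀ + K)),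
        (sh' F θ hP g₀ os).1 K t u = if u ∈ badClassK₁₃ θ K₀ g₀ (kr F θ hP g₀ os) (bd F θ hP g₀ os) K t then weightAK₁₃ θ hP K₀ g₀ os (kr F θ hP g₀ os) K t u
          else (sh F θ hP g₀ os).1 K t u)
    (hfold₂ : letI : DecidableEq (Σ K, SiteSeqKey F (K₀ + K)) := Classical.decEq _
      ∀ (K : ℕ) (t : ℝ) (u : Σ K, SiteSeqKey F (K₀ + K)),
        (sh' F θ hP g₀ os).2 K t u = if u ∈ badClassK₁₃ θ K₀ g₀ (kr F θ hP g₀ os) (bd F θ hP g₀ os) K t then weightBK₁₃ θ hP K₀ g₀ os (kr F θ hP g₀ os) K t u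
          else (sh F θ hP g₀ os).2 K t u)
    (h20 : RelWeightBound (crOfRecord₁₃KAt K₀ kr bd sh F θ hP g₀ os).l₀ (crOfRecord₁₃KAt K₀ kr bd sh F θ hP g₀ os).T (crOfRecord₁₃KAt K₀ kr bd sh F θ hP g₀ os).A
      (crOfRecord₁₃KAt K₀ kr bd sh F θ hP g₀ os).B (crOfRecord₁₃KAt K₀ kr bd sh F θ hP g₀ os).Bad (crOfRecord₁₃KAt K₀ kr bd sh F θ hP g₀ os).W)
    (h21 : ShellWeightBound (crOfRecord₁₃KAt K₀ kr bd sh F θ hP g₀ os).l₀ (crOfRecord₁₃KAt K₀ kr bd sh F θ hP g₀ os).T (crOfRecord₁₃KAt K₀ kr bd sh F θ hP g₀ os).A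
      (crOfRecord₁₃KAt K₀ kr bd sh F θ hP g₀ os).B (crOfRecord₁₃KAt K₀ kr bd sh F θ hP g₀ os).shA (crOfRecord₁₃KAt K₀ kr bd sh F θ hP g₀ os).shB
      (crOfRecord₁₃KAt K₀ kr bd sh F θ hP g₀ os).Wsh) :
    ShellWeightBound (crOfRecord₁₃KAt K₀ kr (fun _ _ _ _ _ _ _ => False) sh' F θ hP g₀ os).l₀ (crOfRecord₁₃KAt K₀ kr (fun _ _ _ _ _ _ _ => False) sh' F θ hP g₀ os).T
      (crOfRecord₁₃KAt K₀ kr (fun _ _ _ _ _ _ _ => False) sh' F θ hP g₀ os).A (crOfRecord₁₃KAt K₀ kr (fun _ _ _ _ _ _ _ => False) sh' F θ hP g₀ os).B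
      (crOfRecord₁₃KAt K₀ kr (fun _ _ _ _ _ _ _ => False) sh' F θ hP g₀ os).shA (crOfRecord₁₃KAt K₀ kr (fun _ _ _ _ _ _ _ => False) sh' F θ hP g₀ os).shB
      (crOfRecord₁₃KAt K₀ kr (fun _ _ _ _ _ _ _ => False) sh' F θ hP g₀ os).Wsh := by
  letI hdec : DecidableEq (Σ K, SiteSeqKey F (K₀ + K)) := Classical.decEq _
  letI : DecidableEq (crOfRecord₁₃KAt K₀ kr bd sh F θ hP g₀ os).ι := hdec
  have hfold := shellWeightBound_foldBad (l₀ := 1) h20 h21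
  have e₁ : (fun (K : ℕ) (t : ℝ) (u : Σ K, SiteSeqKey F (K₀ + K)) =>
      if u ∈ badClassK₁₃ θ K₀ g₀ (kr F θ hP g₀ os) (bd F θ hP g₀ os) K t then weightAK₁₃ θ hP K₀ g₀ os (kr F θ hP g₀ os) K t u else (sh F θ hP g₀ os).1 K t u) =
      (sh' F θ hP g₀ os).1 := by
    funext K t u; exact (hfold₁ K t u).symm
  have e₂ : (fun (K : ℕ) (t : ℝ) (u : Σ K, SiteSeqKey F (K₀ + K)) =>
      if u ∈ badClassK₁₃ θ K₀ g₀ (kr F θ hP g₀ os) (bd F θ hP g₀ os) K t then weightBK₁₃ θ hP K₀ g₀ os (kr F θ hP g₀ os) K t u else (sh F θ hP g₀ os).2 K t u) =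
      (sh' F θ hP g₀ os).2 := by
    funext K t u; exact (hfold₂ K t u).symm
  exact shellWeightBound_crOfRecord₁₃KAt K₀ kr (fun _ _ _ _ _ _ _ => False) sh' θ hP g₀ os (by rw [← e₁, ← e₂]; exact hfold)

/-- ★ **N19′'s ∃δ-EDGE AT `(kr, bd, sh)` ⇒ AT `(kr, ⊥, sh♯)`, SAME `δ`** [bookkeeping] (dag-n19-w1's generic `core_foldBad`: on the `bd`-bad coarse classes both folded cores vanish,
`e^{c−vol·δ}·0 ≤ 0 ≤ e^{c+vol·δ}·0`; off them nothing changes; the reading's fields and its `dec` are the coarse carriers' by `rfl`). -/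
theorem coreEdge_crOfRecord₁₃KAt_badFalse_of_coreEdge
    (hfold₁ : letI : DecidableEq (Σ K, SiteSeqKey F (K₀ + K)) := Classical.decEq _
      ∀ (K : ℕ) (t : ℝ) (u : Σ K, SiteSeqKey F (K₀ + K)),
        (sh' F θ hP g₀ os).1 K t u = if u ∈ badClassK₁₃ θ K₀ g₀ (kr F θ hP g₀ os) (bd F θ hP g₀ os) K t then weightAK₁₃ θ hP K₀ g₀ os (kr F θ hP g₀ os) K t u
          else (sh F θ hP g₀ os).1 K t u)
    (hfold₂ : letI : DecidableEq (Σ K, SiteSeqKey F (K₀ + K)) := Classical.decEq _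
      ∀ (K : ℕ) (t : ℝ) (u : Σ K, SiteSeqKey F (K₀ + K)),
        (sh' F θ hP g₀ os).2 K t u = if u ∈ badClassK₁₃ θ K₀ g₀ (kr F θ hP g₀ os) (bd F θ hP g₀ os) K t then weightBK₁₃ θ hP K₀ g₀ os (kr F θ hP g₀ os) K t u
          else (sh F θ hP g₀ os).2 K t u)
    (h : letI := (crOfRecord₁₃KAt K₀ kr bd sh F θ hP g₀ os).dec
      ∃ δ : ℕ → ℝ, NE7.Core (crOfRecord₁₃KAt K₀ kr bd sh F θ hP g₀ os).l₀ (crOfRecord₁₃KAt K₀ kr bd sh F θ hP g₀ os).vol (crOfRecord₁₃KAt K₀ kr bd sh F θ hP g₀ os).T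
        (crOfRecord₁₃KAt K₀ kr bd sh F θ hP g₀ os).Bad
        (fun K t τ => (crOfRecord₁₃KAt K₀ kr bd sh F θ hP g₀ os).A K t τ - (crOfRecord₁₃KAt K₀ kr bd sh F θ hP g₀ os).shA K t τ)
        (fun K t τ => (crOfRecord₁₃KAt K₀ kr bd sh F θ hP g₀ os).B K t τ - (crOfRecord₁₃KAt K₀ kr bd sh F θ hP g₀ os).shB K t τ) δ ∧ Summable δ) :
    letI := (crOfRecord₁₃KAt K₀ kr (fun _ _ _ _ _ _ _ => False) sh' F θ hP g₀ os).dec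
    ∃ δ : ℕ → ℝ, NE7.Core (crOfRecord₁₃KAt K₀ kr (fun _ _ _ _ _ _ _ => False) sh' F θ hP g₀ os).l₀ (crOfRecord₁₃KAt K₀ kr (fun _ _ _ _ _ _ _ => False) sh' F θ hP g₀ os).vol
      (crOfRecord₁₃KAt K₀ kr (fun _ _ _ _ _ _ _ => False) sh' F θ hP g₀ os).T (crOfRecord₁₃KAt K₀ kr (fun _ _ _ _ _ _ _ => False) sh' F θ hP g₀ os).Bad
      (fun K t τ => (crOfRecord₁₃KAt K₀ kr (fun _ _ _ _ _ _ _ => False) sh' F θ hP g₀ os).A K t τ - (crOfRecord₁₃KAt K₀ kr (fun _ _ _ _ _ _ _ => False) sh' F θ hP g₀ os).shA K t τ)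
      (fun K t τ => (crOfRecord₁₃KAt K₀ kr (fun _ _ _ _ _ _ _ => False) sh' F θ hP g₀ os).B K t τ - (crOfRecord₁₃KAt K₀ kr (fun _ _ _ _ _ _ _ => False) sh' F θ hP g₀ os).shB K t τ)
      δ ∧ Summable δ := by
  letI hdec : DecidableEq (Σ K, SiteSeqKey F (K₀ + K)) := Classical.decEq _
  letI : DecidableEq (crOfRecord₁₃KAt K₀ kr bd sh F θ hP g₀ os).ι := hdec
  letI : DecidableEq (crOfRecord₁₃KAt K₀ kr (fun _ _ _ _ _ _ _ => False) sh' F θ hP g₀ os).ι := hdec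
  obtain ⟨δ, hc, hs⟩ := h
  refine ⟨δ, ?_, hs⟩
  have hfold := core_foldBad (l₀ := 1) (vol := F.side ^ 4) hc
  have e₁ : (fun (K : ℕ) (t : ℝ) (u : Σ K, SiteSeqKey F (K₀ + K)) =>
      if u ∈ badClassK₁₃ θ K₀ g₀ (kr F θ hP g₀ os) (bd F θ hP g₀ os) K t then weightAK₁₃ θ hP K₀ g₀ os (kr F θ hP g₀ os) K t u else (sh F θ hP g₀ os).1 K t u) =
      (sh' F θ hP g₀ os).1 := by
    funext K t u; exact (hfold₁ K t u).symm
  have e₂ : (fun (K : ℕ) (t : ℝ) (u : Σ K, SiteSeqKey F (K₀ + K)) =>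
      if u ∈ badClassK₁₃ θ K₀ g₀ (kr F θ hP g₀ os) (bd F θ hP g₀ os) K t then weightBK₁₃ θ hP K₀ g₀ os (kr F θ hP g₀ os) K t u else (sh F θ hP g₀ os).2 K t u) =
      (sh' F θ hP g₀ os).2 := by
    funext K t u; exact (hfold₂ K t u).symm
  -- the folded cores of `core_foldBad` are the cores of `sh'`, and the empty bad class is `badClassK₁₃ … ⊥`
  intro K
  obtain ⟨c, hcK⟩ := hfold K
  refine ⟨c, fun t ht u hu => ?_⟩
  have hu' : u ∈ classSetK₁₃ θ K₀ g₀ (kr F θ hP g₀ os) K \ ∅ := by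
    rw [Finset.sdiff_empty]
    exact (Finset.mem_sdiff.1 hu).1
  have h1 := hcK t ht u hu'
  have ea : (sh' F θ hP g₀ os).1 K t u =
      (if u ∈ badClassK₁₃ θ K₀ g₀ (kr F θ hP g₀ os) (bd F θ hP g₀ os) K t then weightAK₁₃ θ hP K₀ g₀ os (kr F θ hP g₀ os) K t u else (sh F θ hP g₀ os).1 K t u) := hfold₁ K t u
  have eb : (sh' F θ hP g₀ os).2 K t u =
      (if u ∈ badClassK₁₃ θ K₀ g₀ (kr F θ hP g₀ os) (bd F θ hP g₀ os) K t then weightBK₁₃ θ hP K₀ g₀ os (kr F θ hP g₀ os) K t u else (sh F θ hP g₀ os).2 K t u) := hfold₂ K t u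
  show Real.exp (c - F.side ^ 4 * δ K) * (weightAK₁₃ θ hP K₀ g₀ os (kr F θ hP g₀ os) K t u - (sh' F θ hP g₀ os).1 K t u) ≤
      weightBK₁₃ θ hP K₀ g₀ os (kr F θ hP g₀ os) K t u - (sh' F θ hP g₀ os).2 K t u ∧
    weightBK₁₃ θ hP K₀ g₀ os (kr F θ hP g₀ os) K t u - (sh' F θ hP g₀ os).2 K t u ≤
      Real.exp (c + F.side ^ 4 * δ K) * (weightAK₁₃ θ hP K₀ g₀ os (kr F θ hP g₀ os) K t u - (sh' F θ hP g₀ os).1 K t u)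
  rw [ea, eb]
  exact h1

/-- **THE EXTRACTION BODY DOES NOT READ THE BAD-KEY DIAL OR THE SPLIT** [bookkeeping]: at `(kr, bd, sh)` and at `(kr, bd', sh')` the N27x body of the reading is ONE proposition
(`l₀`, `vol`, `K₀`, `T`, `A`, `B` depend on the key reading only). -/
theorem extraction_crOfRecord₁₃KAt_iff (Z : ℕ → ℝ → ℝ) :
    (0 < (crOfRecord₁₃KAt K₀ kr bd sh F θ hP g₀ os).l₀ ∧ 0 < (crOfRecord₁₃KAt K₀ kr bd sh F θ hP g₀ os).vol ∧
      (∀ (K : ℕ) (t : ℝ), |t| ≤ (crOfRecord₁₃KAt K₀ kr bd sh F θ hP g₀ os).l₀ →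
        Z ((crOfRecord₁₃KAt K₀ kr bd sh F θ hP g₀ os).K₀ + K) t = ∑ τ ∈ (crOfRecord₁₃KAt K₀ kr bd sh F θ hP g₀ os).T K, (crOfRecord₁₃KAt K₀ kr bd sh F θ hP g₀ os).A K t τ) ∧
      (∀ (K : ℕ) (t : ℝ), |t| ≤ (crOfRecord₁₃KAt K₀ kr bd sh F θ hP g₀ os).l₀ →
        Z ((crOfRecord₁₃KAt K₀ kr bd sh F θ hP g₀ os).K₀ + K + 1) t = ∑ τ ∈ (crOfRecord₁₃KAt K₀ kr bd sh F θ hP g₀ os).T K, (crOfRecord₁₃KAt K₀ kr bd sh F θ hP g₀ os).B K t τ)) ↔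
    (0 < (crOfRecord₁₃KAt K₀ kr bd' sh' F θ hP g₀ os).l₀ ∧ 0 < (crOfRecord₁₃KAt K₀ kr bd' sh' F θ hP g₀ os).vol ∧
      (∀ (K : ℕ) (t : ℝ), |t| ≤ (crOfRecord₁₃KAt K₀ kr bd' sh' F θ hP g₀ os).l₀ →
        Z ((crOfRecord₁₃KAt K₀ kr bd' sh' F θ hP g₀ os).K₀ + K) t = ∑ τ ∈ (crOfRecord₁₃KAt K₀ kr bd' sh' F θ hP g₀ os).T K, (crOfRecord₁₃KAt K₀ kr bd' sh' F θ hP g₀ os).A K t τ) ∧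
      (∀ (K : ℕ) (t : ℝ), |t| ≤ (crOfRecord₁₃KAt K₀ kr bd' sh' F θ hP g₀ os).l₀ →
        Z ((crOfRecord₁₃KAt K₀ kr bd' sh' F θ hP g₀ os).K₀ + K + 1) t =
          ∑ τ ∈ (crOfRecord₁₃KAt K₀ kr bd' sh' F θ hP g₀ os).T K, (crOfRecord₁₃KAt K₀ kr bd' sh' F θ hP g₀ os).B K t τ)) :=
  Iff.rfl

end PerTuple

/-! ## §2  The stub-2 body AT A KEY READING: any witness folds to an empty-bad-class witness (shapes of K3⁷ v5 spelled out, generic letters) -/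

section Body

variable (kr : KeyReading₁₃ N 0) (Live G : (F : T4Family) → Stage13HParams F N → Prop)
  (Prem : (F : T4Family) → (θ : Stage13HParams F N) → θ.Provisos₁₃CoPH F N → (ℕ → ℝ) → List (ULoop F) → Prop)

/-- ★★ **ANY STUB-2 WITNESS AT THE KEY READING `kr` FOLDS TO AN EMPTY-BAD-CLASS WITNESS** [bookkeeping].  Shapes as in K3⁷ v5 with the pin `PinnedAtLiveK kr bd sh cr` :=
«`Live F θ → cr F θ hP g₀ os = crOfRecord₁₃K kr bd sh F θ hP g₀ os`» (dag-n20-d's suggested v6 pin-with-dial; v5's pin is its instance at the identity dial).  Given a witness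
`(bd, sh, cr)`, the folded split `sh♯` and the reading `crOfRecord₁₃K kr ⊥ sh♯` ON the live line ∕ `cr` OFF it witness the body with the EMPTY bad-key reading `⊥`. -/
theorem exists_badFalse_of_exists
    (h : ∃ (bd : BadKeyReading₁₃ N 0) (sh : ShellSplit₁₃CoPH N 0) (cr : SpineReading₁₃CoPH N),
      (∀ (F : T4Family) (θ : Stage13HParams F N) (hP : θ.Provisos₁₃CoPH F N) (g₀ : ℕ → ℝ) (os : List (ULoop F)),
          Live F θ → cr F θ hP g₀ os = crOfRecord₁₃K kr bd sh F θ hP g₀ os) ∧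
      (∀ (F : T4Family) (θ : Stage13HParams F N) (hP : θ.Provisos₁₃CoPH F N), G F θ → θ.Admissible F N → ∀ (g₀ : ℕ → ℝ) (os : List (ULoop F)),
          RelWeightBound (cr F θ hP g₀ os).l₀ (cr F θ hP g₀ os).T (cr F θ hP g₀ os).A (cr F θ hP g₀ os).B (cr F θ hP g₀ os).Bad (cr F θ hP g₀ os).W) ∧
      (∀ (F : T4Family) (θ : Stage13HParams F N) (hP : θ.Provisos₁₃CoPH F N), G F θ → θ.Admissible F N → ∀ (g₀ : ℕ → ℝ) (os : List (ULoop F)),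
          ShellWeightBound (cr F θ hP g₀ os).l₀ (cr F θ hP g₀ os).T (cr F θ hP g₀ os).A (cr F θ hP g₀ os).B (cr F θ hP g₀ os).shA (cr F θ hP g₀ os).shB
            (cr F θ hP g₀ os).Wsh) ∧
      (∀ (F : T4Family) (θ : Stage13HParams F N) (hP : θ.Provisos₁₃CoPH F N), G F θ → θ.Admissible F N →
          B16.EndStatementBPrinted (datumOfRecord₁₃CoPH F N θ hP).C → DagBinding.EndpointExistence (datumOfRecord₁₃CoPH F N θ hP).C.toB12 →
            ForSmallCouplings (datumOfRecord₁₃CoPH F N θ hP) fun g₀ => ∀ os : List (ULoop F),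
              0 < (cr F θ hP g₀ os).l₀ ∧ 0 < (cr F θ hP g₀ os).vol ∧
              (∀ (K : ℕ) (t : ℝ), |t| ≤ (cr F θ hP g₀ os).l₀ →
                T4GenFunBounds.schemeZ ((datumOfRecord₁₃CoPH F N θ hP).scheme g₀) os ((cr F θ hP g₀ os).K₀ + K) t =
                  ∑ τ ∈ (cr F θ hP g₀ os).T K, (cr F θ hP g₀ os).A K t τ) ∧
              (∀ (K : ℕ) (t : ℝ), |t| ≤ (cr F θ hP g₀ os).l₀ →
                T4GenFunBounds.schemeZ ((datumOfRecord₁₃CoPH F N θ hP).scheme g₀) os ((cr F θ hP g₀ os).K₀ + K + 1) t =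
                  ∑ τ ∈ (cr F θ hP g₀ os).T K, (cr F θ hP g₀ os).B K t τ)) ∧
      (∀ (F : T4Family) (θ : Stage13HParams F N) (hP : θ.Provisos₁₃CoPH F N), G F θ → θ.Admissible F N →
          B16.EndStatementBPrinted (datumOfRecord₁₃CoPH F N θ hP).C → DagBinding.EndpointExistence (datumOfRecord₁₃CoPH F N θ hP).C.toB12 →
            ForSmallCouplings (datumOfRecord₁₃CoPH F N θ hP) fun g₀ => ∀ os : List (ULoop F),
              Prem F θ hP g₀ os → letI := (cr F θ hP g₀ os).dec
                ∃ δ : ℕ → ℝ, NE7.Core (cr F θ hP g₀ os).l₀ (cr F θ hP g₀ os).vol (cr F θ hP g₀ os).T (cr F θ hP g₀ os).Bad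
                  (fun K t τ => (cr F θ hP g₀ os).A K t τ - (cr F θ hP g₀ os).shA K t τ)
                  (fun K t τ => (cr F θ hP g₀ os).B K t τ - (cr F θ hP g₀ os).shB K t τ) δ ∧ Summable δ)) :
    ∃ (sh : ShellSplit₁₃CoPH N 0) (cr : SpineReading₁₃CoPH N),
      (∀ (F : T4Family) (θ : Stage13HParams F N) (hP : θ.Provisos₁₃CoPH F N) (g₀ : ℕ → ℝ) (os : List (ULoop F)),
          Live F θ → cr F θ hP g₀ os = crOfRecord₁₃K kr (fun _ _ _ _ _ _ _ => False) sh F θ hP g₀ os) ∧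
      (∀ (F : T4Family) (θ : Stage13HParams F N) (hP : θ.Provisos₁₃CoPH F N), G F θ → θ.Admissible F N → ∀ (g₀ : ℕ → ℝ) (os : List (ULoop F)),
          RelWeightBound (cr F θ hP g₀ os).l₀ (cr F θ hP g₀ os).T (cr F θ hP g₀ os).A (cr F θ hP g₀ os).B (cr F θ hP g₀ os).Bad (cr F θ hP g₀ os).W) ∧
      (∀ (F : T4Family) (θ : Stage13HParams F N) (hP : θ.Provisos₁₃CoPH F N), G F θ → θ.Admissible F N → ∀ (g₀ : ℕ → ℝ) (os : List (ULoop F)),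
          ShellWeightBound (cr F θ hP g₀ os).l₀ (cr F θ hP g₀ os).T (cr F θ hP g₀ os).A (cr F θ hP g₀ os).B (cr F θ hP g₀ os).shA (cr F θ hP g₀ os).shB
            (cr F θ hP g₀ os).Wsh) ∧
      (∀ (F : T4Family) (θ : Stage13HParams F N) (hP : θ.Provisos₁₃CoPH F N), G F θ → θ.Admissible F N →
          B16.EndStatementBPrinted (datumOfRecord₁₃CoPH F N θ hP).C → DagBinding.EndpointExistence (datumOfRecord₁₃CoPH F N θ hP).C.toB12 →
            ForSmallCouplings (datumOfRecord₁₃CoPH F N θ hP) fun g₀ => ∀ os : List (ULoop F),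
              0 < (cr F θ hP g₀ os).l₀ ∧ 0 < (cr F θ hP g₀ os).vol ∧
              (∀ (K : ℕ) (t : ℝ), |t| ≤ (cr F θ hP g₀ os).l₀ →
                T4GenFunBounds.schemeZ ((datumOfRecord₁₃CoPH F N θ hP).scheme g₀) os ((cr F θ hP g₀ os).K₀ + K) t =
                  ∑ τ ∈ (cr F θ hP g₀ os).T K, (cr F θ hP g₀ os).A K t τ) ∧
              (∀ (K : ℕ) (t : ℝ), |t| ≤ (cr F θ hP g₀ os).l₀ →
                T4GenFunBounds.schemeZ ((datumOfRecord₁₃CoPH F N θ hP).scheme g₀) os ((cr F θ hP g₀ os).K₀ + K + 1) t =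
                  ∑ τ ∈ (cr F θ hP g₀ os).T K, (cr F θ hP g₀ os).B K t τ)) ∧
      (∀ (F : T4Family) (θ : Stage13HParams F N) (hP : θ.Provisos₁₃CoPH F N), G F θ → θ.Admissible F N →
          B16.EndStatementBPrinted (datumOfRecord₁₃CoPH F N θ hP).C → DagBinding.EndpointExistence (datumOfRecord₁₃CoPH F N θ hP).C.toB12 →
            ForSmallCouplings (datumOfRecord₁₃CoPH F N θ hP) fun g₀ => ∀ os : List (ULoop F),
              Prem F θ hP g₀ os → letI := (cr F θ hP g₀ os).dec
                ∃ δ : ℕ → ℝ, NE7.Core (cr F θ hP g₀ os).l₀ (cr F θ hP g₀ os).vol (cr F θ hP g₀ os).T (cr F θ hP g₀ os).Bad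
                  (fun K t τ => (cr F θ hP g₀ os).A K t τ - (cr F θ hP g₀ os).shA K t τ)
                  (fun K t τ => (cr F θ hP g₀ os).B K t τ - (cr F θ hP g₀ os).shB K t τ) δ ∧ Summable δ) := by
  classical
  obtain ⟨bd, sh, cr, hpin, h20, h21, hx, h19⟩ := h
  -- the folded split: the whole coarse class weight on the `bd`-bad coarse classes, `sh` off them
  let shS : ShellSplit₁₃CoPH N 0 := fun F θ hP g₀ os =>
    (fun K t u => if u ∈ badClassK₁₃ θ 0 g₀ (kr F θ hP g₀ os) (bd F θ hP g₀ os) K t then weightAK₁₃ θ hP 0 g₀ os (kr F θ hP g₀ os) K t u else (sh F θ hP g₀ os).1 K t u,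
     fun K t u => if u ∈ badClassK₁₃ θ 0 g₀ (kr F θ hP g₀ os) (bd F θ hP g₀ os) K t then weightBK₁₃ θ hP 0 g₀ os (kr F θ hP g₀ os) K t u else (sh F θ hP g₀ os).2 K t u)
  -- the folded reading: the empty-bad-class reading ON the live line, the given reading OFF it
  let crS : SpineReading₁₃CoPH N := fun F θ hP g₀ os =>
    if Live F θ then crOfRecord₁₃K kr (fun _ _ _ _ _ _ _ => False) shS F θ hP g₀ os else cr F θ hP g₀ os
  have hon : ∀ (F : T4Family) (θ : Stage13HParams F N) (hP : θ.Provisos₁₃CoPH F N) (g₀ : ℕ → ℝ) (os : List (ULoop F)),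
      Live F θ → crS F θ hP g₀ os = crOfRecord₁₃KAt 0 kr (fun _ _ _ _ _ _ _ => False) shS F θ hP g₀ os := fun F θ hP g₀ os hL => if_pos hL
  have hoff : ∀ (F : T4Family) (θ : Stage13HParams F N) (hP : θ.Provisos₁₃CoPH F N) (g₀ : ℕ → ℝ) (os : List (ULoop F)),
      ¬ Live F θ → crS F θ hP g₀ os = cr F θ hP g₀ os := fun F θ hP g₀ os hL => if_neg hL
  have hpin' : ∀ (F : T4Family) (θ : Stage13HParams F N) (hP : θ.Provisos₁₃CoPH F N) (g₀ : ℕ → ℝ) (os : List (ULoop F)),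
      Live F θ → cr F θ hP g₀ os = crOfRecord₁₃KAt 0 kr bd sh F θ hP g₀ os := fun F θ hP g₀ os hL => hpin F θ hP g₀ os hL
  have hfold₁ : ∀ (F : T4Family) (θ : Stage13HParams F N) (hP : θ.Provisos₁₃CoPH F N) (g₀ : ℕ → ℝ) (os : List (ULoop F)),
      letI : DecidableEq (Σ K, SiteSeqKey F (0 + K)) := Classical.decEq _
      ∀ (K : ℕ) (t : ℝ) (u : Σ K, SiteSeqKey F (0 + K)),
        (shS F θ hP g₀ os).1 K t u = if u ∈ badClassK₁₃ θ 0 g₀ (kr F θ hP g₀ os) (bd F θ hP g₀ os) K t then weightAK₁₃ θ hP 0 g₀ os (kr F θ hP g₀ os) K t u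
          else (sh F θ hP g₀ os).1 K t u := by
    intro F θ hP g₀ os K t u
    show (if u ∈ badClassK₁₃ θ 0 g₀ (kr F θ hP g₀ os) (bd F θ hP g₀ os) K t then weightAK₁₃ θ hP 0 g₀ os (kr F θ hP g₀ os) K t u else (sh F θ hP g₀ os).1 K t u) = _
    split_ifs <;> rfl
  have hfold₂ : ∀ (F : T4Family) (θ : Stage13HParams F N) (hP : θ.Provisos₁₃CoPH F N) (g₀ : ℕ → ℝ) (os : List (ULoop F)),
      letI : DecidableEq (Σ K, SiteSeqKey F (0 + K)) := Classical.decEq _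
      ∀ (K : ℕ) (t : ℝ) (u : Σ K, SiteSeqKey F (0 + K)),
        (shS F θ hP g₀ os).2 K t u = if u ∈ badClassK₁₃ θ 0 g₀ (kr F θ hP g₀ os) (bd F θ hP g₀ os) K t then weightBK₁₃ θ hP 0 g₀ os (kr F θ hP g₀ os) K t u
          else (sh F θ hP g₀ os).2 K t u := by
    intro F θ hP g₀ os K t u
    show (if u ∈ badClassK₁₃ θ 0 g₀ (kr F θ hP g₀ os) (bd F θ hP g₀ os) K t then weightBK₁₃ θ hP 0 g₀ os (kr F θ hP g₀ os) K t u else (sh F θ hP g₀ os).2 K t u) = _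
    split_ifs <;> rfl
  refine ⟨shS, crS, fun F θ hP g₀ os hL => hon F θ hP g₀ os hL, ?_, ?_, ?_, ?_⟩
  · -- N20: free at the empty bad-key reading ON the live line; the given face OFF it
    intro F θ hP hG hθ g₀ os
    by_cases hL : Live F θ
    · rw [hon F θ hP g₀ os hL]
      exact relWeightBound_crOfRecord₁₃KAt_badFalse 0 kr shS θ hP g₀ os
    · rw [hoff F θ hP g₀ os hL]
      exact h20 F θ hP hG hθ g₀ os
  · -- N21: the budget-free fold of §1 ON the live line
    intro F θ hP hG hθ g₀ os
    by_cases hL : Live F θ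
    · rw [hon F θ hP g₀ os hL]
      have h20' := h20 F θ hP hG hθ g₀ os
      have h21' := h21 F θ hP hG hθ g₀ os
      rw [hpin' F θ hP g₀ os hL] at h20' h21'
      exact shellWeightBound_crOfRecord₁₃KAt_badFalse_of_faces 0 kr bd sh shS θ hP g₀ os (hfold₁ F θ hP g₀ os) (hfold₂ F θ hP g₀ os) h20' h21'
    · rw [hoff F θ hP g₀ os hL]
      exact h21 F θ hP hG hθ g₀ os
  · -- N27x: the extraction body does not read the bad-key dial or the split
    intro F θ hP hG hθ hB hE
    by_cases hL : Live F θ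
    · refine ForSmallCouplings.mono (fun g₀ hg os => ?_) (hx F θ hP hG hθ hB hE)
      have hg' := hg os
      rw [hpin' F θ hP g₀ os hL] at hg'
      rw [hon F θ hP g₀ os hL]
      exact (extraction_crOfRecord₁₃KAt_iff 0 kr bd (fun _ _ _ _ _ _ _ => False) sh shS θ hP g₀ os _).1 hg'
    · refine ForSmallCouplings.mono (fun g₀ hg os => ?_) (hx F θ hP hG hθ hB hE)
      rw [hoff F θ hP g₀ os hL]
      exact hg os
  · -- N19′: the same `δ` after the fold, under the prefix
    intro F θ hP hG hθ hB hE
    by_cases hL : Live F θ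
    · refine ForSmallCouplings.mono (fun g₀ hg os hprem => ?_) (h19 F θ hP hG hθ hB hE)
      have hg' := hg os hprem
      rw [hpin' F θ hP g₀ os hL] at hg'
      rw [hon F θ hP g₀ os hL]
      exact coreEdge_crOfRecord₁₃KAt_badFalse_of_coreEdge 0 kr bd sh shS θ hP g₀ os (hfold₁ F θ hP g₀ os) (hfold₂ F θ hP g₀ os) hg'
    · refine ForSmallCouplings.mono (fun g₀ hg os hprem => ?_) (h19 F θ hP hG hθ hB hE)
      rw [hoff F θ hP g₀ os hL]
      exact hg os hprem

/-- ★★ **THE BAD-KEY DIAL OF STUB 2 IS ELIMINABLE AT EVERY KEY READING** [bookkeeping]: at the key reading `kr`, the stub-2 body with `∃ (bd : BadKeyReading₁₃ N 0)` and the body with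
the EMPTY bad-key reading are EQUIVALENT (the converse direction: `⊥` is a bad-key reading). -/
theorem stubTwoBodyK_iff_badFalse :
    (∃ (bd : BadKeyReading₁₃ N 0) (sh : ShellSplit₁₃CoPH N 0) (cr : SpineReading₁₃CoPH N),
      (∀ (F : T4Family) (θ : Stage13HParams F N) (hP : θ.Provisos₁₃CoPH F N) (g₀ : ℕ → ℝ) (os : List (ULoop F)),
          Live F θ → cr F θ hP g₀ os = crOfRecord₁₃K kr bd sh F θ hP g₀ os) ∧
      (∀ (F : T4Family) (θ : Stage13HParams F N) (hP : θ.Provisos₁₃CoPH F N), G F θ → θ.Admissible F N → ∀ (g₀ : ℕ → ℝ) (os : List (ULoop F)),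
          RelWeightBound (cr F θ hP g₀ os).l₀ (cr F θ hP g₀ os).T (cr F θ hP g₀ os).A (cr F θ hP g₀ os).B (cr F θ hP g₀ os).Bad (cr F θ hP g₀ os).W) ∧
      (∀ (F : T4Family) (θ : Stage13HParams F N) (hP : θ.Provisos₁₃CoPH F N), G F θ → θ.Admissible F N → ∀ (g₀ : ℕ → ℝ) (os : List (ULoop F)),
          ShellWeightBound (cr F θ hP g₀ os).l₀ (cr F θ hP g₀ os).T (cr F θ hP g₀ os).A (cr F θ hP g₀ os).B (cr F θ hP g₀ os).shA (cr F θ hP g₀ os).shB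
            (cr F θ hP g₀ os).Wsh) ∧
      (∀ (F : T4Family) (θ : Stage13HParams F N) (hP : θ.Provisos₁₃CoPH F N), G F θ → θ.Admissible F N →
          B16.EndStatementBPrinted (datumOfRecord₁₃CoPH F N θ hP).C → DagBinding.EndpointExistence (datumOfRecord₁₃CoPH F N θ hP).C.toB12 →
            ForSmallCouplings (datumOfRecord₁₃CoPH F N θ hP) fun g₀ => ∀ os : List (ULoop F),
              0 < (cr F θ hP g₀ os).l₀ ∧ 0 < (cr F θ hP g₀ os).vol ∧
              (∀ (K : ℕ) (t : ℝ), |t| ≤ (cr F θ hP g₀ os).l₀ →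
                T4GenFunBounds.schemeZ ((datumOfRecord₁₃CoPH F N θ hP).scheme g₀) os ((cr F θ hP g₀ os).K₀ + K) t =
                  ∑ τ ∈ (cr F θ hP g₀ os).T K, (cr F θ hP g₀ os).A K t τ) ∧
              (∀ (K : ℕ) (t : ℝ), |t| ≤ (cr F θ hP g₀ os).l₀ →
                T4GenFunBounds.schemeZ ((datumOfRecord₁₃CoPH F N θ hP).scheme g₀) os ((cr F θ hP g₀ os).K₀ + K + 1) t =
                  ∑ τ ∈ (cr F θ hP g₀ os).T K, (cr F θ hP g₀ os).B K t τ)) ∧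
      (∀ (F : T4Family) (θ : Stage13HParams F N) (hP : θ.Provisos₁₃CoPH F N), G F θ → θ.Admissible F N →
          B16.EndStatementBPrinted (datumOfRecord₁₃CoPH F N θ hP).C → DagBinding.EndpointExistence (datumOfRecord₁₃CoPH F N θ hP).C.toB12 →
            ForSmallCouplings (datumOfRecord₁₃CoPH F N θ hP) fun g₀ => ∀ os : List (ULoop F),
              Prem F θ hP g₀ os → letI := (cr F θ hP g₀ os).dec
                ∃ δ : ℕ → ℝ, NE7.Core (cr F θ hP g₀ os).l₀ (cr F θ hP g₀ os).vol (cr F θ hP g₀ os).T (cr F θ hP g₀ os).Bad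
                  (fun K t τ => (cr F θ hP g₀ os).A K t τ - (cr F θ hP g₀ os).shA K t τ)
                  (fun K t τ => (cr F θ hP g₀ os).B K t τ - (cr F θ hP g₀ os).shB K t τ) δ ∧ Summable δ)) ↔
    ∃ (sh : ShellSplit₁₃CoPH N 0) (cr : SpineReading₁₃CoPH N),
      (∀ (F : T4Family) (θ : Stage13HParams F N) (hP : θ.Provisos₁₃CoPH F N) (g₀ : ℕ → ℝ) (os : List (ULoop F)),
          Live F θ → cr F θ hP g₀ os = crOfRecord₁₃K kr (fun _ _ _ _ _ _ _ => False) sh F θ hP g₀ os) ∧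
      (∀ (F : T4Family) (θ : Stage13HParams F N) (hP : θ.Provisos₁₃CoPH F N), G F θ → θ.Admissible F N → ∀ (g₀ : ℕ → ℝ) (os : List (ULoop F)),
          RelWeightBound (cr F θ hP g₀ os).l₀ (cr F θ hP g₀ os).T (cr F θ hP g₀ os).A (cr F θ hP g₀ os).B (cr F θ hP g₀ os).Bad (cr F θ hP g₀ os).W) ∧
      (∀ (F : T4Family) (θ : Stage13HParams F N) (hP : θ.Provisos₁₃CoPH F N), G F θ → θ.Admissible F N → ∀ (g₀ : ℕ → ℝ) (os : List (ULoop F)),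
          ShellWeightBound (cr F θ hP g₀ os).l₀ (cr F θ hP g₀ os).T (cr F θ hP g₀ os).A (cr F θ hP g₀ os).B (cr F θ hP g₀ os).shA (cr F θ hP g₀ os).shB
            (cr F θ hP g₀ os).Wsh) ∧
      (∀ (F : T4Family) (θ : Stage13HParams F N) (hP : θ.Provisos₁₃CoPH F N), G F θ → θ.Admissible F N →
          B16.EndStatementBPrinted (datumOfRecord₁₃CoPH F N θ hP).C → DagBinding.EndpointExistence (datumOfRecord₁₃CoPH F N θ hP).C.toB12 →
            ForSmallCouplings (datumOfRecord₁₃CoPH F N θ hP) fun g₀ => ∀ os : List (ULoop F),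
              0 < (cr F θ hP g₀ os).l₀ ∧ 0 < (cr F θ hP g₀ os).vol ∧
              (∀ (K : ℕ) (t : ℝ), |t| ≤ (cr F θ hP g₀ os).l₀ →
                T4GenFunBounds.schemeZ ((datumOfRecord₁₃CoPH F N θ hP).scheme g₀) os ((cr F θ hP g₀ os).K₀ + K) t =
                  ∑ τ ∈ (cr F θ hP g₀ os).T K, (cr F θ hP g₀ os).A K t τ) ∧
              (∀ (K : ℕ) (t : ℝ), |t| ≤ (cr F θ hP g₀ os).l₀ →
                T4GenFunBounds.schemeZ ((datumOfRecord₁₃CoPH F N θ hP).scheme g₀) os ((cr F θ hP g₀ os).K₀ + K + 1) t =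
                  ∑ τ ∈ (cr F θ hP g₀ os).T K, (cr F θ hP g₀ os).B K t τ)) ∧
      (∀ (F : T4Family) (θ : Stage13HParams F N) (hP : θ.Provisos₁₃CoPH F N), G F θ → θ.Admissible F N →
          B16.EndStatementBPrinted (datumOfRecord₁₃CoPH F N θ hP).C → DagBinding.EndpointExistence (datumOfRecord₁₃CoPH F N θ hP).C.toB12 →
            ForSmallCouplings (datumOfRecord₁₃CoPH F N θ hP) fun g₀ => ∀ os : List (ULoop F),
              Prem F θ hP g₀ os → letI := (cr F θ hP g₀ os).dec
                ∃ δ : ℕ → ℝ, NE7.Core (cr F θ hP g₀ os).l₀ (cr F θ hP g₀ os).vol (cr F θ hP g₀ os).T (cr F θ hP g₀ os).Bad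
                  (fun K t τ => (cr F θ hP g₀ os).A K t τ - (cr F θ hP g₀ os).shA K t τ)
                  (fun K t τ => (cr F θ hP g₀ os).B K t τ - (cr F θ hP g₀ os).shB K t τ) δ ∧ Summable δ) :=
  ⟨exists_badFalse_of_exists kr Live G Prem, fun ⟨sh, cr, hpin, h20, h21, hx, h19⟩ => ⟨fun _ _ _ _ _ _ _ => False, sh, cr, hpin, h20, h21, hx, h19⟩⟩

end Body

end Summit.QuantumFields.YangMills.BalabanUVNodes.N20BadDialEliminationAtKeyReading

end
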